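import Summits.FinalStateConjecture.FinalStateConjecture.Theorems.ClusterCompletenessOmegaLimitMultiKerrDefs
import Summits.FinalStateConjecture.FinalStateConjecture.Theorems.ClusterCompletenessLinearToNonlinearCaptureStubIsOpenSubsetChronologicalPast
import HarnessLib

/-!
# Crux `ClusterCompleteness.OmegaLimitMultiKerr` (stmt-FinalStateConjecture-14664), line `Sketch` —
# a settled development recurs at every order `k ≤ 2`

Support lemmas of the line lead (gen 1) for the crux `OmegaLimitMultiKerr` (the anchored generic
ω-limit dichotomy "for every order `k`, Christodoulou-generically an MGHD exists and every MGHD that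
does NOT settle down RECURS at order `k`"), over the landed vocabulary `Settles` / `Recurs k` /
`OmegaAt k` of `ClusterCompletenessOmegaLimitMultiKerrDefs`.

* `exists_diagonal_radius` — the diagonal lemma: if a `[0, ∞]`-valued quantity `f R τ` tends to `0`
  as `τ → ∞` for every fixed radius `R`, there are radii `S(τ) → ∞` along which `f (S τ) τ → 0`.
* `recurs_of_finalStateDecomposition` — THE STRUCTURE LEMMA: the chart data of an exhaustive `Cᵏ'`
  sub-extremal final-state decomposition `d` of `O = exteriorOf d.charted` (the settle disjunct minus
  complete `𝓘⁺`, at any order `k'`) satisfy the recur interface `Recurs k` for every `k ≤ k'`: restart all charts at a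
  chart time `τ₀' ≥ d.τ₀` beyond which the `C⁰` anchor (deviation `≤ 1/4` on every flat slab and every
  certified near-zone slab) holds, with exhaustion radii `Rᵢ τ ⊔ Sᵢ τ → ∞` (`Rᵢ` the radii of
  `HasExhaustiveCharts`, `Sᵢ` diagonal radii of the fixed-radius near-zone convergence); exhaustion is
  monotone in the radii and in the region, the restarted charted region lies in its own chronological
  past (`stub_isOpen_subset_chronologicalPast`), and convergence gives recurrence.
* `recurs_of_settles` — hence `Settles 𝒟 → Recurs k 𝒟` for `k ≤ 2`: at low order the two disjuncts
  of the crux are NESTED, and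
* `omegaAt_iff_recurs_of_le_two` — for `k ≤ 2` the crux at order `k` is literally "generically, an
  MGHD exists and EVERY MGHD recurs at order `k`" (the `¬ Settles` guard is idle at low order; the
  content of the `∀ k` crux sits at large `k`, `omegaAt_anti`).

Everything is proved; Mathlib + the landed `Theorems` files only.
-/

-- every `Summit.FinalStateConjecture.FinalStateConjecture.…` name repeats the summit = sub-problem segment (D-0017 layout)
set_option linter.dupNamespace false

noncomputable section

open scoped Manifold ContDiff Topology ENNReal
open Set Filter TopologicalSpace

namespace Summit.FinalStateConjecture.FinalStateConjecture.Theorems.ClusterCompleteness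

open Literature.Geometry.Lorentzian

universe u

/-! ### The diagonal lemma -/

/-- **Diagonal radii.** If `f R τ → 0` as `τ → ∞` for every fixed `R : ℝ` (values in `[0, ∞]`),
then there is a radius function `S : ℝ → ℝ` with `S τ → ∞` and `f (S τ) τ → 0` as `τ → ∞`
(choose thresholds `tₙ` with `f n τ ≤ n⁻¹` for `τ ≥ tₙ`, and let `S τ` be the last `n ≤ ⌈τ⌉₊` with
`max n tₙ ≤ τ`). No monotonicity of `f` is needed. [folklore] -/
theorem exists_diagonal_radius {f : ℝ → ℝ → ℝ≥0∞}
    (h : ∀ R : ℝ, Tendsto (fun τ ↦ f R τ) atTop (𝓝 0)) :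
    ∃ S : ℝ → ℝ, Tendsto S atTop atTop ∧ Tendsto (fun τ ↦ f (S τ) τ) atTop (𝓝 0) := by
  classical
  -- thresholds `t n` with `f n τ ≤ n⁻¹` for `τ ≥ t n`
  have hε : ∀ n : ℕ, (0 : ℝ≥0∞) < (n : ℝ≥0∞)⁻¹ := fun n ↦
    ENNReal.inv_pos.mpr (ENNReal.natCast_ne_top n)
  have ht : ∀ n : ℕ, ∃ t : ℝ, ∀ τ, t ≤ τ → f n τ ≤ (n : ℝ≥0∞)⁻¹ := fun n ↦
    eventually_atTop.mp ((h n).eventually (ge_mem_nhds (hε n)))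
  choose t ht using ht
  -- `T n := max n (t n)`; `Sn τ` := the last `n ≤ ⌈τ⌉₊` with `T n ≤ τ`
  let T : ℕ → ℝ := fun n ↦ max (n : ℝ) (t n)
  let Sn : ℝ → ℕ := fun τ ↦ Nat.findGreatest (fun n ↦ T n ≤ τ) ⌈τ⌉₊
  have hle_ceil : ∀ n (τ : ℝ), T n ≤ τ → n ≤ ⌈τ⌉₊ := fun n τ hn ↦
    Nat.cast_le.mp (((le_max_left _ _).trans hn).trans (Nat.le_ceil τ))
  have hSn_ge : ∀ n (τ : ℝ), T n ≤ τ → n ≤ Sn τ := fun n τ hn ↦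
    Nat.le_findGreatest (hle_ceil n τ hn) hn
  have hSn_spec : ∀ τ : ℝ, T 0 ≤ τ → T (Sn τ) ≤ τ := fun τ h0 ↦
    Nat.findGreatest_spec (P := fun n ↦ T n ≤ τ) (Nat.zero_le _) h0
  have hSn : Tendsto Sn atTop atTop :=
    tendsto_atTop_atTop.mpr fun n ↦ ⟨T n, fun τ hτ ↦ hSn_ge n τ hτ⟩
  refine ⟨fun τ ↦ (Sn τ : ℝ), tendsto_natCast_atTop_atTop.comp hSn, ?_⟩
  -- `f (Sn τ) τ ≤ (Sn τ)⁻¹ → 0`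
  have hbound : ∀ᶠ τ in atTop, f (Sn τ) τ ≤ ((Sn τ : ℕ) : ℝ≥0∞)⁻¹ := by
    filter_upwards [eventually_ge_atTop (T 0)] with τ hτ
    exact ht (Sn τ) τ ((le_max_right _ _).trans (hSn_spec τ hτ))
  exact tendsto_of_tendsto_of_tendsto_of_le_of_le' tendsto_const_nhds
    (ENNReal.tendsto_inv_nat_nhds_zero.comp hSn) (Eventually.of_forall fun _ ↦ zero_le) hbound

/-! ### Sup norms over unions; truncated slabs with the larger of two radii -/

section SupNorm

variable {F G : Type*} [NormedAddCommGroup F] [NormedSpace ℝ F] [NormedAddCommGroup G]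
  [NormedSpace ℝ G]

/-- The `Cᵏ` sup norm over a union is the larger of the two sup norms. [folklore] -/
theorem supCkENorm_union (s t : Set F) (k : ℕ) (f : F → G) :
    supCkENorm (s ∪ t) k f = supCkENorm s k f ⊔ supCkENorm t k f := by
  simp only [supCkENorm, iSup_union, iSup_sup_eq]

end SupNorm

/-- The truncated slab of radius `R ⊔ S` is the union of the truncated slabs of radii `R`, `S`.
[folklore] -/
theorem truncTimeSlab_sup (B : ModelBackground) (R S τ : ℝ) :
    B.truncTimeSlab (R ⊔ S) τ = B.truncTimeSlab R τ ∪ B.truncTimeSlab S τ := by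
  ext x
  simp only [ModelBackground.mem_truncTimeSlab, le_sup_iff, mem_union]
  tauto

/-- The truncated `Cᵏ` deviation out to radius `R ⊔ S` is the larger of the two truncated
deviations. [folklore] -/
theorem truncDeviationCk_sup (𝓢 : Spacetime.{u} 4) (B : ModelBackground)
    (Ψ : B.domain → 𝓢.carrier) (k : ℕ) (R S τ : ℝ) :
    𝓢.truncDeviationCk B Ψ k (R ⊔ S) τ =
      𝓢.truncDeviationCk B Ψ k R τ ⊔ 𝓢.truncDeviationCk B Ψ k S τ := by
  simp only [Spacetime.truncDeviationCk, truncTimeSlab_sup, image_union, supCkENorm_union]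

/-! ### Restarting late charts -/

/-- A late region `{t > τ}` of a reference background with continuous time function is open in the
reference domain. [folklore] -/
private theorem isOpen_lateRegion_of_continuous_time (B : ModelBackground) (hB : Continuous B.time)
    (τ : ℝ) : IsOpen (B.lateRegion τ) :=
  isOpen_lt continuous_const (hB.comp continuous_subtype_val)

/-- Restarting a late chart at a later time: a late chart after `τ₀` into `O` is a late chart after
any `τ₁ ≥ τ₀` into any region containing the image of the (open) late region `{t > τ₁}`.
[folklore] -/
private theorem isLateChart_restart {𝓢 : Spacetime.{u} 4} {B : ModelBackground}
    {O O' : Set 𝓢.carrier} {τ₀ τ₁ : ℝ} {Ψ : B.domain → 𝓢.carrier}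
    (h : 𝓢.IsLateChart B O τ₀ Ψ) (hτ : τ₀ ≤ τ₁) (hopen : IsOpen (B.lateRegion τ₁))
    (hO' : Ψ '' B.lateRegion τ₁ ⊆ O') : 𝓢.IsLateChart B O' τ₁ Ψ where
  contMDiff := h.contMDiff
  isOpenEmbedding := h.isOpenEmbedding.comp
    (Topology.IsOpenEmbedding.inclusion (B.lateRegion_mono hτ)
      (hopen.preimage continuous_subtype_val))
  image_subset := hO'

/-- The image of a later (open) late region under a late chart is open in the spacetime.
[folklore] -/
private theorem isOpen_image_lateRegion {𝓢 : Spacetime.{u} 4} {B : ModelBackground}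
    {O : Set 𝓢.carrier} {τ₀ τ₁ : ℝ} {Ψ : B.domain → 𝓢.carrier}
    (h : 𝓢.IsLateChart B O τ₀ Ψ) (hτ : τ₀ ≤ τ₁) (hopen : IsOpen (B.lateRegion τ₁)) :
    IsOpen (Ψ '' B.lateRegion τ₁) := by
  rw [← range_restrict]
  exact (h.isOpenEmbedding.comp (Topology.IsOpenEmbedding.inclusion (B.lateRegion_mono hτ)
    (hopen.preimage continuous_subtype_val))).isOpen_range

/-! ### A settled development recurs at order `≤ 2` -/

section PerDevelopment

variable {X : Type} [TopologicalSpace X] [ChartedSpace E3 X] [IsManifold (𝓡 3) ∞ X]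
  [ConnectedSpace X] {D : InitialDataSet (𝓡 3) X}

/-- **An exhaustive sub-extremal `Cᵏ'` final-state decomposition recurs at every order `k ≤ k'`.**
Let `d` be a `Cᵏ'` final-state decomposition of `O = J⁺(Σ) ∩ I⁻(d.charted)` with sub-extremal holes
whose charts exhaust `O` (`HasExhaustiveCharts d`). Then the recur interface `Recurs k 𝒟` holds for
`k ≤ k'`, with the SAME labels, motions, charts, excision radii and flat domain: restart all charts at
a chart time `τ₀' ≥ d.τ₀` after which the `C⁰` deviation is `≤ 1/4` on every flat slab and on every
near-zone slab truncated at `R̃ᵢ(τ) := Rᵢ τ ⊔ Sᵢ τ` (`Rᵢ` the exhaustion radii of `d`, `Sᵢ → ∞`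
diagonal radii of the fixed-radius near-zone convergence, `exists_diagonal_radius`), take
`O' := exteriorOf (charted late region after τ₀') ⊆ O`; exhaustion of `O'` follows from exhaustion of
`O` by monotonicity in the radii, the restarted (open) charted region lies in `O'` because an open set
lies in its own chronological past (`stub_isOpen_subset_chronologicalPast`), separation and
sublinearity are inherited, and `Cᵏ'`-convergence gives `Cᵏ` `ε`-recurrence for every `ε > 0` and
every near-zone radius (the Statement's case is `k' = 2`). [folklore] -/
theorem recurs_of_finalStateDecomposition (𝒟 : VacuumCauchyDevelopment D) {O : Set 𝒟.carrier}
    {k' : ℕ} (d : FinalStateDecomposition 𝒟.toSpacetime O k')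
    (hsub : ∀ i, Kerr.IsSubextremal (d.mass i) (d.spin i))
    (hO : O = Summit.FinalStateConjecture.exteriorOf 𝒟.toCauchyDevelopment d.charted)
    (hexh : Summit.FinalStateConjecture.HasExhaustiveCharts d) {k : ℕ} (hk : k ≤ k') :
    Recurs k 𝒟 := by
  -- (buildfix 2026-08-20, proof-only: `HasExhaustiveCharts` gained a leading clause `Rᵢ → ∞ ∧ Rᵢ ≥ …`
  -- in the 2026-08-16 audit; it is not needed here)
  obtain ⟨R, -, hRconv, hRexh⟩ := hexh
  replace hRconv : ∀ i, Tendsto (fun τ ↦ 𝒟.toSpacetime.truncDeviationCk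
      (boostedKerrBackground (d.motion i).1 (d.motion i).2 (d.mass i) (d.spin i)) (d.chart i) k'
        (R i τ) τ) atTop (𝓝 0) := fun i ↦ hRconv i
  -- diagonal radii `S i → ∞` of the fixed-radius near-zone convergence, and `R̃ i := R i ⊔ S i`
  choose S hS hSconv using fun i ↦ exists_diagonal_radius (d.tendsto_truncDeviationCk i)
  have hRt : ∀ i, Tendsto (fun τ ↦ 𝒟.toSpacetime.truncDeviationCk
      (boostedKerrBackground (d.motion i).1 (d.motion i).2 (d.mass i) (d.spin i)) (d.chart i) k'
        (R i τ ⊔ S i τ) τ) atTop (𝓝 0) := by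
    intro i
    have h : Tendsto (fun τ ↦ 𝒟.toSpacetime.truncDeviationCk
        (boostedKerrBackground (d.motion i).1 (d.motion i).2 (d.mass i) (d.spin i)) (d.chart i) k'
          (R i τ) τ ⊔ 𝒟.toSpacetime.truncDeviationCk
        (boostedKerrBackground (d.motion i).1 (d.motion i).2 (d.mass i) (d.spin i)) (d.chart i) k'
          (S i τ) τ) atTop (𝓝 0) := by
      simpa only [sup_idem] using (hRconv i).sup_nhds (hSconv i)
    refine tendsto_of_tendsto_of_tendsto_of_le_of_le tendsto_const_nhds h (fun _ ↦ zero_le)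
      fun τ ↦ ?_
    exact (truncDeviationCk_sup 𝒟.toSpacetime
      (boostedKerrBackground (d.motion i).1 (d.motion i).2 (d.mass i) (d.spin i)) (d.chart i) k'
      (R i τ) (S i τ) τ).le
  -- order-`0` versions of the convergence clauses
  have hflat0 : Tendsto (fun τ ↦ 𝒟.toSpacetime.deviationCk (Minkowski.backgroundOn d.flatDomain)
      d.flatChart 0 τ) atTop (𝓝 0) :=
    tendsto_of_tendsto_of_tendsto_of_le_of_le tendsto_const_nhds d.tendsto_deviationCk_flat
      (fun _ ↦ zero_le) fun τ ↦ 𝒟.toSpacetime.deviationCk_mono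
        (Minkowski.backgroundOn d.flatDomain) d.flatChart (Nat.zero_le k') τ
  have hholes0 : ∀ i, Tendsto (fun τ ↦ 𝒟.toSpacetime.truncDeviationCk
      (boostedKerrBackground (d.motion i).1 (d.motion i).2 (d.mass i) (d.spin i)) (d.chart i) 0
        (R i τ ⊔ S i τ) τ) atTop (𝓝 0) := fun i ↦
    tendsto_of_tendsto_of_tendsto_of_le_of_le tendsto_const_nhds (hRt i) (fun _ ↦ zero_le)
      fun τ ↦ supCkENorm_mono_right _ (Nat.zero_le k') _
  -- the anchor threshold `τs` and the restart time `τ₀' := max τs d.τ₀`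
  have hq : (0 : ℝ≥0∞) < ENNReal.ofReal (1 / 4) := ENNReal.ofReal_pos.mpr (by norm_num)
  obtain ⟨τs, hτs⟩ := eventually_atTop.mp ((hflat0.eventually (ge_mem_nhds hq)).and
    (eventually_all.mpr fun i ↦ (hholes0 i).eventually (ge_mem_nhds hq)))
  set τ₀' : ℝ := max τs d.τ₀ with hτ₀'
  have h0' : d.τ₀ ≤ τ₀' := le_max_right _ _
  have hs' : τs ≤ τ₀' := le_max_left _ _
  -- continuity of the chart times, openness of the late regions
  have hcK : ∀ i, Continuous
      (boostedKerrBackground (d.motion i).1 (d.motion i).2 (d.mass i) (d.spin i)).time :=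
    fun i ↦ (PiLp.continuous_apply 2 _ 0).comp (continuous_poincareInv _ _)
  have hc0 : Continuous (Minkowski.backgroundOn d.flatDomain).time := PiLp.continuous_apply 2 _ 0
  have hoK : ∀ i (τ : ℝ), IsOpen
      ((boostedKerrBackground (d.motion i).1 (d.motion i).2 (d.mass i) (d.spin i)).lateRegion τ) :=
    fun i τ ↦ isOpen_lateRegion_of_continuous_time _ (hcK i) τ
  have ho0 : ∀ τ : ℝ, IsOpen ((Minkowski.backgroundOn d.flatDomain).lateRegion τ) :=
    fun τ ↦ isOpen_lateRegion_of_continuous_time _ hc0 τ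
  -- the restarted charted region `C'`: open, inside `d.charted`, inside `O`
  have hC'open : IsOpen ((⋃ i, d.chart i '' (boostedKerrBackground (d.motion i).1 (d.motion i).2
      (d.mass i) (d.spin i)).lateRegion τ₀') ∪
      d.flatChart '' (Minkowski.backgroundOn d.flatDomain).lateRegion τ₀') :=
    (isOpen_iUnion fun i ↦ isOpen_image_lateRegion (d.isLateChart i) h0' (hoK i _)).union
      (isOpen_image_lateRegion d.isLateChart_flat h0' (ho0 _))
  have hC'sub : ((⋃ i, d.chart i '' (boostedKerrBackground (d.motion i).1 (d.motion i).2
      (d.mass i) (d.spin i)).lateRegion τ₀') ∪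
      d.flatChart '' (Minkowski.backgroundOn d.flatDomain).lateRegion τ₀') ⊆ d.charted :=
    union_subset
      (subset_union_of_subset_right (iUnion_mono fun i ↦ image_mono
        ((boostedKerrBackground (d.motion i).1 (d.motion i).2 (d.mass i)
          (d.spin i)).lateRegion_mono h0')) _)
      (subset_union_of_subset_left
        (image_mono ((Minkowski.backgroundOn d.flatDomain).lateRegion_mono h0')) _)
  have hOJ : O ⊆ 𝒟.metric.causalFuture 𝒟.timeOrientation (range 𝒟.embed) := by
    rw [hO]
    exact fun p hp ↦ hp.1
  have hC'O' : ((⋃ i, d.chart i '' (boostedKerrBackground (d.motion i).1 (d.motion i).2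
      (d.mass i) (d.spin i)).lateRegion τ₀') ∪
      d.flatChart '' (Minkowski.backgroundOn d.flatDomain).lateRegion τ₀') ⊆
      Summit.FinalStateConjecture.exteriorOf 𝒟.toCauchyDevelopment
        ((⋃ i, d.chart i '' (boostedKerrBackground (d.motion i).1 (d.motion i).2
          (d.mass i) (d.spin i)).lateRegion τ₀') ∪
          d.flatChart '' (Minkowski.backgroundOn d.flatDomain).lateRegion τ₀') :=
    subset_inter ((hC'sub.trans d.charted_subset).trans hOJ)
      (stub_isOpen_subset_chronologicalPast _ hC'open)
  have hO'O : Summit.FinalStateConjecture.exteriorOf 𝒟.toCauchyDevelopment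
      ((⋃ i, d.chart i '' (boostedKerrBackground (d.motion i).1 (d.motion i).2
        (d.mass i) (d.spin i)).lateRegion τ₀') ∪
        d.flatChart '' (Minkowski.backgroundOn d.flatDomain).lateRegion τ₀') ⊆ O := fun p hp ↦
    hO ▸ (⟨hp.1, LorentzianMetric.chronologicalFuture_mono (τ := 𝒟.timeOrientation.reverse)
      hC'sub hp.2⟩ : p ∈ Summit.FinalStateConjecture.exteriorOf 𝒟.toCauchyDevelopment d.charted)
  -- the recur interface, witnessed by the restarted charts
  refine ⟨Summit.FinalStateConjecture.exteriorOf 𝒟.toCauchyDevelopment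
      ((⋃ i, d.chart i '' (boostedKerrBackground (d.motion i).1 (d.motion i).2
        (d.mass i) (d.spin i)).lateRegion τ₀') ∪
        d.flatChart '' (Minkowski.backgroundOn d.flatDomain).lateRegion τ₀'),
    d.N, d.mass, d.spin, d.motion, τ₀', d.chart, d.excision, fun i τ ↦ R i τ ⊔ S i τ,
    d.flatDomain, d.flatChart, hsub, fun i ↦ ?_, ?_, d.tendsto_excision_div, fun i ↦ ?_, ?_,
    d.exists_pairwise_disjoint, rfl, fun τ₁ hτ₁ ↦ ?_, fun τ hτ ↦ ?_, fun R' ε hε ↦ ?_⟩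
  · -- hole charts, restarted at `τ₀'`
    exact isLateChart_restart (d.isLateChart i) h0' (hoK i _)
      ((subset_iUnion (fun i ↦ d.chart i '' (boostedKerrBackground (d.motion i).1 (d.motion i).2
        (d.mass i) (d.spin i)).lateRegion τ₀') i).trans (subset_union_left.trans hC'O'))
  · -- flat chart, restarted at `τ₀'`
    exact isLateChart_restart d.isLateChart_flat h0' (ho0 _) (subset_union_right.trans hC'O')
  · -- the exhaustion radii tend to infinity
    exact tendsto_atTop_mono (fun τ ↦ le_sup_right) (hS i)
  · -- the flat domain contains the later half-space minus the excised tubes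
    exact fun x hx ↦ d.setOf_lt_excision_subset_flatDomain ⟨h0'.trans_lt hx.1, hx.2⟩
  · -- exhaustion of `O' ⊆ O` at `τ₁ > τ₀' ≥ d.τ₀`, from exhaustion of `O` with the smaller radii
    intro p hp
    have hp' : p ∈ O \ Summit.FinalStateConjecture.certifiedLate d R τ₁ := by
      refine ⟨hO'O hp.1, fun h ↦ hp.2 ?_⟩
      refine union_subset_union Subset.rfl (iUnion_mono fun i ↦ image_mono fun x hx ↦ ?_) h
      exact ⟨hx.1, hx.2.trans le_sup_left⟩
    exact LorentzianMetric.causalFuture_mono (τ := 𝒟.timeOrientation.reverse)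
      (union_subset_union Subset.rfl (iUnion_mono fun i ↦ image_mono
        ((boostedKerrBackground (d.motion i).1 (d.motion i).2 (d.mass i)
          (d.spin i)).truncTimeSlab_mono le_sup_left τ₁)))
      (hRexh τ₁ (h0'.trans_lt hτ₁) hp')
  · -- the uniform `C⁰` anchor after `τ₀' ≥ τs`
    exact hτs τ (hs'.trans hτ.le)
  · -- `Cᵏ` `ε`-recurrence, `k ≤ k'`, for every near-zone radius `R'`, from `Cᵏ'` convergence
    have hε' : (0 : ℝ≥0∞) < ENNReal.ofReal ε := ENNReal.ofReal_pos.mpr hε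
    have hflatk : Tendsto (fun τ ↦ 𝒟.toSpacetime.deviationCk
        (Minkowski.backgroundOn d.flatDomain) d.flatChart k τ) atTop (𝓝 0) :=
      tendsto_of_tendsto_of_tendsto_of_le_of_le tendsto_const_nhds d.tendsto_deviationCk_flat
        (fun _ ↦ zero_le) fun τ ↦ 𝒟.toSpacetime.deviationCk_mono
          (Minkowski.backgroundOn d.flatDomain) d.flatChart hk τ
    have hholesk : ∀ i, Tendsto (fun τ ↦ 𝒟.toSpacetime.truncDeviationCk
        (boostedKerrBackground (d.motion i).1 (d.motion i).2 (d.mass i) (d.spin i)) (d.chart i) k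
          R' τ) atTop (𝓝 0) := fun i ↦
      tendsto_of_tendsto_of_tendsto_of_le_of_le tendsto_const_nhds (d.tendsto_truncDeviationCk i R')
        (fun _ ↦ zero_le) fun τ ↦ supCkENorm_mono_right _ hk _
    exact ((hflatk.eventually (ge_mem_nhds hε')).and
      (eventually_all.mpr fun i ↦ (hholesk i).eventually (ge_mem_nhds hε'))).frequently

end PerDevelopment

/-- **A settled development recurs at every order `k ≤ 2`** (registered stub `recurs_of_settles` of
the crux's line `Sketch`). If the maximal development `𝒟` settles down in the sense of the Statement
(complete `𝓘⁺` and an exhaustive `C²` sub-extremal multi-Kerr decomposition of its self-determined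
exterior), then it satisfies the recur interface `Recurs k` of the crux for every `k ≤ 2` (with its
own labels, motions and charts, restarted where the `C⁰` anchor holds): at low order the two
disjuncts of `OmegaLimitMultiKerr` are nested. [folklore] -/
theorem recurs_of_settles : ∀ {X : Type} [TopologicalSpace X] [ChartedSpace E3 X]
    [IsManifold (𝓡 3) ∞ X] [ConnectedSpace X] {D : InitialDataSet (𝓡 3) X}
    (𝒟 : VacuumCauchyDevelopment D) {k : ℕ}, k ≤ 2 → Settles 𝒟 → Recurs k 𝒟 := by
  intro X _ _ _ _ D 𝒟 k hk h
  obtain ⟨-, O, d, hsub, hO, hexh⟩ := h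
  exact recurs_of_finalStateDecomposition 𝒟 d hsub hO hexh hk

section Genericity

variable {E : Type*} [NormedAddCommGroup E] [NormedSpace ℝ E] {H : Type*} [TopologicalSpace H]
  {I : ModelWithCorners ℝ E H} {X : Type*} [TopologicalSpace X] [ChartedSpace H X]
  [IsManifold I ((⊤ : ℕ∞) : WithTop ℕ∞) X]

/-- Christodoulou's curve-genericity is monotone in the property (local copy of
`Theorems.CaptureSuffices.Negative.isChristodoulouGeneric_mono`, to keep this module's import
cone inside the route). [folklore] -/
private theorem isChristodoulouGeneric_mono' {𝓓 : Set (InitialDataSet I X)}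
    {P Q : InitialDataSet I X → Prop} (hPQ : ∀ d ∈ 𝓓, P d → Q d) {m : ℕ}
    (h : InitialDataSet.IsChristodoulouGeneric 𝓓 P m) :
    InitialDataSet.IsChristodoulouGeneric 𝓓 Q m := by
  intro d hd
  obtain ⟨F, hF, h0, hinj, hadm, hexc⟩ := h d ⟨hd.1, fun hP ↦ hd.2 (hPQ d hd.1 hP)⟩
  exact ⟨F, hF, h0, hinj, hadm,
    fun c hc hmem ↦ hexc c hc ⟨hmem.1, fun hP ↦ hmem.2 (hPQ _ hmem.1 hP)⟩⟩

end Genericity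

/-- **At order `k ≤ 2` the `¬ Settles` guard of the crux is idle**: `OmegaAt k` (the crux
`OmegaLimitMultiKerr` at one order `k`) is equivalent to "for every connected Hausdorff
second-countable `3`-manifold, Christodoulou-generically in the admissible class an MGHD exists and
EVERY MGHD recurs at order `k`" — because a settled MGHD recurs at order `≤ 2`
(`recurs_of_settles`). The content of the `∀ k` crux is carried by large `k` (`omegaAt_anti`).
[folklore] -/
theorem omegaAt_iff_recurs_of_le_two {k : ℕ} (hk : k ≤ 2) :
    OmegaAt k ↔
      ∀ (X : Type) [TopologicalSpace X] [ChartedSpace E3 X] [IsManifold (𝓡 3) ∞ X] [T2Space X]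
        [SecondCountableTopology X] [ConnectedSpace X],
        InitialDataSet.IsChristodoulouGeneric (admissibleVacuumData X)
          (fun D ↦ (∃ 𝒟 : VacuumCauchyDevelopment D, 𝒟.IsMaximal) ∧
            ∀ 𝒟 : VacuumCauchyDevelopment D, 𝒟.IsMaximal → Recurs k 𝒟) 1 := by
  refine ⟨fun h X _ _ _ _ _ _ ↦ ?_, fun h X _ _ _ _ _ _ ↦ ?_⟩
  · refine isChristodoulouGeneric_mono' (fun D _ hP ↦ ⟨hP.1, fun 𝒟 h𝒟 ↦ ?_⟩) (h X)
    by_cases hS : Settles 𝒟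
    · exact recurs_of_settles 𝒟 hk hS
    · exact hP.2 𝒟 h𝒟 hS
  · exact isChristodoulouGeneric_mono' (fun D _ hP ↦ ⟨hP.1, fun 𝒟 h𝒟 _ ↦ hP.2 𝒟 h𝒟⟩) (h X)

end Summit.FinalStateConjecture.FinalStateConjecture.Theorems.ClusterCompleteness

end
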